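import Summits.KontsevichZagierPeriods.KontsevichZagierPeriods.Theorems.LinRedNormalFormArrangementNormalFormSeparateThreeHIContact
import Summits.KontsevichZagierPeriods.KontsevichZagierPeriods.Theorems.LinRedNormalFormArrangementNormalFormSeparateThreeHILetters
import Summits.KontsevichZagierPeriods.KontsevichZagierPeriods.Theorems.LinRedNormalFormArrangementNormalFormSeparateThreeHIPoly

/-!
# Fibre bounds of the Taylor pieces near a rim vertex, by type of direction

(Line `janus-bands`, crux `ArrangementNormalForm`, stub `stub_separateThreeZero`, part `HIRimDirs`
of the termwise numerator split `separateThree_hI` under the rim condition.)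

At a rim point `(v₀, 0)` of the closed cell on the pole plane, the fibre integral `FI i (v₀ + u)`
of the `i`-th absolute Taylor piece over the vertical fibre (= cone fibre `Kfib u`) is bounded
according to the type of the direction of `u`:
* THICK or CONTACT directions (fibres `(lo, hi)` with `0 ≤ lo ≤ θ hi`): `FI i ≤ C · FF` by the
  one-dimensional brick (`bound_of_thick`);
* MODERATE directions: `FI i ≤ C · FF` by the moderate fibre lemma (`bound_of_moderate`);
* RIM directions: `FI i ≤ C ‖u‖⁻¹` by POWER COUNTING — the upper power bound of the pieces, the
  lower bound of the letter block on transversal displacements and the exponent inequality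
  (`bound_of_rim`, registered as `separateThree_rimDirs`); the letters through `v₀` are transversal
  to rim directions by the rim condition (`rim_letters`, `Wt_lower_dir`).
-/

noncomputable section

open Set MeasureTheory Filter Topology
open scoped ENNReal

namespace Summit.KontsevichZagierPeriods.ArrangementNormalForm.JanusBands

namespace SepThree

section RimDirs

variable {J m : ℕ} (g : Fin J → Con) (κ : Fin m → Fin 2 → ℝ) (μ : Fin m → ℝ) (e : Fin m → ℕ)
  (N : ℕ) (q : ℕ → MvPolynomial (Fin 2) ℝ) (n : ℕ) (v₀ : Fin 2 → ℝ)
  (hB : (bots g v₀).Nonempty) (hT : (tops g v₀).Nonempty)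

/-! ### Thick and contact directions: the brick -/

include hB hT in
/-- **Thick fibres.** If the non-empty cone fibres near a direction are intervals `(lo, hi)` with
`0 ≤ lo ≤ θ hi`, the fibre integrals of the pieces are dominated by that of the integrand. -/
theorem bound_of_thick {θ : ℝ} (hθ0 : 0 < θ) (hθ1 : θ < 1) (i : ℕ) (hi : i < N) :
    ∃ C : ℝ≥0∞, C ≠ ∞ ∧ ∀ u : Fin 2 → ℝ, fib (Om3 g) (v₀ + u) = Kfib g v₀ u →
      ((Kfib g v₀ u).Nonempty → Kfib g v₀ u = Ioo (hlo g v₀ hB u) (hhi g v₀ hT u) ∧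
        0 ≤ hlo g v₀ hB u ∧ hlo g v₀ hB u ≤ θ * hhi g v₀ hT u) →
      FI κ μ e q n (Om3 g) i (v₀ + u) ≤ C * FF κ μ e N q n (Om3 g) (v₀ + u) := by
  obtain ⟨C, hC, hbrick⟩ := brick N n hθ0 hθ1
  refine ⟨C, hC, fun u hfib hthick => ?_⟩
  rcases (Kfib g v₀ u).eq_empty_or_nonempty with hemp | hne
  · rw [FI_eq_zero_of_empty κ μ e q n i (by rw [hfib, hemp])]
    exact zero_le
  · obtain ⟨hK, hlo0, hloθ⟩ := hthick hne
    refine FI_le_of_fibre κ μ e N q n ?_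
    rw [hfib, hK]
    exact hbrick (fun j => Qv q j (v₀ + u)) _ _ hlo0 hloθ i hi

/-! ### Moderate directions -/

/-- **Moderate fibres.** If the non-empty cone fibres near a direction contain `‖u‖ [a₀, b₀]` and
lie in `‖u‖ (A₁, B₁)`, `0 < A₁`, the fibre integrals of the pieces are dominated by that of the
integrand. -/
theorem bound_of_moderate {a₀ b₀ A₁ B₁ : ℝ} (hA : 0 < A₁) (h1 : A₁ < a₀) (h2 : a₀ < b₀)
    (h3 : b₀ < B₁) (i : ℕ) (hi : i < N) :
    ∃ C : ℝ≥0∞, C ≠ ∞ ∧ ∀ u : Fin 2 → ℝ, u ≠ 0 → fib (Om3 g) (v₀ + u) = Kfib g v₀ u →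
      ((Kfib g v₀ u).Nonempty → Icc (‖u‖ * a₀) (‖u‖ * b₀) ⊆ Kfib g v₀ u ∧
        Kfib g v₀ u ⊆ Ioo (‖u‖ * A₁) (‖u‖ * B₁)) →
      FI κ μ e q n (Om3 g) i (v₀ + u) ≤ C * FF κ μ e N q n (Om3 g) (v₀ + u) := by
  obtain ⟨C, hC, hmod⟩ := moderate_fibre N n hA h1 h2 h3
  refine ⟨C, hC, fun u hu hfib hmoder => ?_⟩
  rcases (Kfib g v₀ u).eq_empty_or_nonempty with hemp | hne
  · rw [FI_eq_zero_of_empty κ μ e q n i (by rw [hfib, hemp])]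
    exact zero_le
  · obtain ⟨hin, hout⟩ := hmoder hne
    refine FI_le_of_fibre κ μ e N q n ?_
    have hmeas : MeasurableSet (Kfib g v₀ u) := by
      rw [← hfib]; exact measurableSet_fib (measurableSet_Om3 g) _
    rw [hfib]
    exact hmod (fun j => Qv q j (v₀ + u)) ‖u‖ (norm_pos_iff.2 hu) _ hmeas hin hout i hi

/-! ### Rim directions: power counting -/

/-- **Rim fibres.** On cone fibres inside `‖u‖ (A₁, B₁)`, `0 < A₁`, with the letter block bounded
below by `cW ‖u‖^E`, the exponent inequality `n + E < ord c + 3` for the Taylor data `c` of the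
numerator at `(v₀, 0)` gives `FI i (v₀ + u) ≤ C ‖u‖⁻¹`. -/
theorem bound_of_rim {A₁ B₁ : ℝ} (hA : 0 < A₁) (hAB : A₁ < B₁) {cW : ℝ} (hcW : 0 < cW)
    {d : ℕ} (hNd : N ≤ d + 1) (c : Coef d)
    (hc : ∀ (i : ℕ) (hi : i < N) (u : Fin 2 → ℝ),
      MvPolynomial.eval (v₀ + u) (q i) = SepTwo.pev₂ (c ⟨i, lt_of_lt_of_le hi hNd⟩) (u 0) (u 1))
    (h : (nz c).Nonempty) (hexp : n + Eord κ μ e v₀ < ord c h + 3) (i : ℕ) (hi : i < N) :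
    ∃ δ > 0, ∃ C : ℝ≥0∞, C ≠ ∞ ∧ ∀ u : Fin 2 → ℝ, u ≠ 0 → ‖u‖ < δ →
      fib (Om3 g) (v₀ + u) = Kfib g v₀ u → Kfib g v₀ u ⊆ Ioo (‖u‖ * A₁) (‖u‖ * B₁) →
      cW * ‖u‖ ^ Eord κ μ e v₀ ≤ |Wt κ μ e (v₀ + u)| →
      FI κ μ e q n (Om3 g) i (v₀ + u) ≤ C * ENNReal.ofReal ‖u‖⁻¹ := by
  set M := max 1 B₁ with hM
  have hM1 : 1 ≤ M := le_max_left _ _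
  have hM0 : 0 < M := by positivity
  set E := Eord κ μ e v₀ with hE
  set K₁ : ℝ := cabs c * M ^ ord c h / (cW * A₁ ^ n) with hK₁
  have hK₁0 : 0 ≤ K₁ := by simp only [hK₁]; exact div_nonneg (mul_nonneg (cabs_nonneg c) (by positivity)) (by positivity)
  have hBA : 0 < B₁ - A₁ := by linarith
  refine ⟨1 / M, by positivity, ENNReal.ofReal (K₁ * (B₁ - A₁)), ENNReal.ofReal_ne_top,
    fun u hu hδ hfib hsub hW => ?_⟩
  set ρ := ‖u‖ with hρ
  have hρ0 : 0 < ρ := norm_pos_iff.2 hu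
  have hρM : M * ρ ≤ 1 := by
    have := mul_lt_mul_of_pos_left hδ hM0
    rw [mul_one_div, div_self hM0.ne'] at this
    exact this.le
  have hρ1 : ρ ≤ 1 := le_trans (by nlinarith) hρM
  have hWpos : 0 < |Wt κ μ e (v₀ + u)| := lt_of_lt_of_le (mul_pos hcW (pow_pos hρ0 _)) hW
  -- pointwise bound of the piece on the fibre
  have hpt : ∀ t ∈ Kfib g v₀ u, ‖tpiece κ μ e q n i (v₀ + u, t)‖ₑ ≤
      ENNReal.ofReal (K₁ * (ρ ^ ord c h / (ρ ^ E * ρ ^ n))) := by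
    intro t ht
    obtain ⟨ht1, ht2⟩ := hsub ht
    have ht0 : 0 < t := (mul_pos hρ0 hA).trans ht1
    have hnorm : ‖((u, t) : (Fin 2 → ℝ) × ℝ)‖ ≤ M * ρ := by
      rw [Prod.norm_def, Real.norm_eq_abs, abs_of_pos ht0, max_le_iff]
      constructor
      · rw [← hρ]; nlinarith
      · calc t ≤ ρ * B₁ := ht2.le
          _ ≤ ρ * M := mul_le_mul_of_nonneg_left (le_max_right _ _) hρ0.le
          _ = M * ρ := mul_comm _ _
    have hnorm1 : ‖((u, t) : (Fin 2 → ℝ) × ℝ)‖ ≤ 1 := hnorm.trans hρM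
    have hnum : |Qv q i (v₀ + u) * t ^ i| ≤ cabs c * (M * ρ) ^ ord c h := by
      have := term_le_pow_ord h ⟨i, lt_of_lt_of_le hi hNd⟩ hnorm1
      simp only [Qv, hc i hi u]
      refine this.trans (mul_le_mul_of_nonneg_left (pow_le_pow_left₀ (norm_nonneg _) hnorm _)
        (cabs_nonneg c))
    have htn : (ρ * A₁) ^ n ≤ t ^ n := pow_le_pow_left₀ (by positivity) ht1.le _
    rw [Real.enorm_eq_ofReal_abs]
    refine ENNReal.ofReal_le_ofReal ?_
    have hexpr : |tpiece κ μ e q n i (v₀ + u, t)| = |Qv q i (v₀ + u) * t ^ i| / (|Wt κ μ e (v₀ + u)| * t ^ n) := by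
      simp only [tpiece]
      rw [div_mul_div_comm, abs_div, abs_mul (Wt κ μ e (v₀ + u)) (t ^ n), abs_pow t n, abs_of_pos ht0]
    rw [hexpr, div_le_iff₀ (mul_pos hWpos (pow_pos ht0 _))]
    calc |Qv q i (v₀ + u) * t ^ i| ≤ cabs c * (M * ρ) ^ ord c h := hnum
      _ = K₁ * (ρ ^ ord c h / (ρ ^ E * ρ ^ n)) * ((cW * ρ ^ E) * (ρ * A₁) ^ n) := by
          simp only [hK₁]; rw [mul_pow, mul_pow]; field_simp
      _ ≤ K₁ * (ρ ^ ord c h / (ρ ^ E * ρ ^ n)) * (|Wt κ μ e (v₀ + u)| * t ^ n) := by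
          refine mul_le_mul_of_nonneg_left (mul_le_mul hW htn (by positivity) (abs_nonneg _)) ?_
          positivity
  -- integrate over the fibre of length at most `ρ (B₁ - A₁)`
  have hvol : volume (Kfib g v₀ u) ≤ ENNReal.ofReal (ρ * (B₁ - A₁)) := by
    calc volume (Kfib g v₀ u) ≤ volume (Ioo (ρ * A₁) (ρ * B₁)) := measure_mono hsub
      _ = ENNReal.ofReal (ρ * (B₁ - A₁)) := by rw [Real.volume_Ioo]; ring_nf
  have hpow : ρ ^ ord c h / (ρ ^ E * ρ ^ n) * (ρ * (B₁ - A₁)) ≤ (B₁ - A₁) * ρ⁻¹ := by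
    rw [div_mul_eq_mul_div, div_le_iff₀ (by positivity), ← pow_add]
    have hle : ρ ^ (ord c h + 2) ≤ ρ ^ (E + n) := pow_le_pow_of_le_one hρ0.le hρ1 (by omega)
    have e1 : ρ ^ ord c h * (ρ * (B₁ - A₁)) = (B₁ - A₁) * ρ⁻¹ * ρ ^ (ord c h + 2) := by
      rw [pow_add]; field_simp
    rw [e1]
    exact mul_le_mul_of_nonneg_left hle (by positivity)
  unfold FI
  calc ∫⁻ w in fib (Om3 g) (v₀ + u), ‖tpiece κ μ e q n i (v₀ + u, w)‖ₑ
      = ∫⁻ w in Kfib g v₀ u, ‖tpiece κ μ e q n i (v₀ + u, w)‖ₑ := by rw [hfib]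
    _ ≤ ∫⁻ _ in Kfib g v₀ u, ENNReal.ofReal (K₁ * (ρ ^ ord c h / (ρ ^ E * ρ ^ n))) :=
        setLIntegral_mono measurable_const hpt
    _ = ENNReal.ofReal (K₁ * (ρ ^ ord c h / (ρ ^ E * ρ ^ n))) * volume (Kfib g v₀ u) := setLIntegral_const _ _
    _ ≤ ENNReal.ofReal (K₁ * (ρ ^ ord c h / (ρ ^ E * ρ ^ n))) * ENNReal.ofReal (ρ * (B₁ - A₁)) := by gcongr
    _ = ENNReal.ofReal (K₁ * (ρ ^ ord c h / (ρ ^ E * ρ ^ n) * (ρ * (B₁ - A₁)))) := by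
        rw [← ENNReal.ofReal_mul (by positivity)]; ring_nf
    _ ≤ ENNReal.ofReal (K₁ * ((B₁ - A₁) * ρ⁻¹)) :=
        ENNReal.ofReal_le_ofReal (mul_le_mul_of_nonneg_left hpow hK₁0)
    _ = ENNReal.ofReal (K₁ * (B₁ - A₁)) * ENNReal.ofReal ρ⁻¹ := by
        rw [← ENNReal.ofReal_mul (by positivity)]; ring_nf

/-! ### Rim directions: the letters through `v₀` are transversal -/

include hB hT in
/-- **Rim condition ⟹ transversality.** At a rim direction `d` (`0 < hlo d = hhi d`, admitted by the
active vertical constraints) no letter of non-zero exponent through `v₀` contains `d`. -/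
theorem rim_letters (hcl : ((v₀, 0) : (Fin 2 → ℝ) × ℝ) ∈ closure (Om3 g))
    (hR : ∀ p ∈ closure (Om3 g), (∃ j, e j ≠ 0 ∧ lval κ μ j p.1 = 0) →
      (n ≠ 0 ∧ p.2 = 0) ∨ ∃ p' ∈ closure (Om3 g), p' ≠ p ∧ p'.1 = p.1)
    {d : Fin 2 → ℝ} (h1 : 0 < hlo g v₀ hB d) (h2 : hlo g v₀ hB d = hhi g v₀ hT d)
    (hv : ∀ j ∈ act g v₀, (g j).2.1 = 0 → 0 ≤ blin (g j) d) :
    ∀ j, e j ≠ 0 → lval κ μ j v₀ = 0 → κ j 0 * d 0 + κ j 1 * d 1 ≠ 0 := by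
  intro j hej hjv hkd
  obtain ⟨r₁, hr₁, hclos⟩ := closure_of_active_nonneg g v₀ hcl
  set qd : (Fin 2 → ℝ) × ℝ := (d, hlo g v₀ hB d) with hqd
  have hqd0 : 0 < ‖qd‖ := norm_pos_iff.2 (fun h0 => by
    have := congrArg Prod.snd h0
    simp only [hqd, Prod.snd_zero] at this
    linarith)
  set s : ℝ := r₁ / (2 * ‖qd‖) with hs
  have hs0 : 0 < s := by positivity
  have hsnorm : ‖s • qd‖ < r₁ := by
    have : s * ‖qd‖ = r₁ / 2 := by rw [hs]; field_simp
    rw [norm_smul, Real.norm_eq_abs, abs_of_pos hs0, this]; linarith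
  -- the active constraints are non-negative on `qd`
  have hact : ∀ k ∈ act g v₀, 0 ≤ clin (g k) qd := by
    intro k hk
    rcases lt_trichotomy 0 ((g k).2.1) with hc | hc | hc
    · rw [hqd, clin_eq_mul_sub _ _ _ hc.ne']
      refine mul_nonneg hc.le (sub_nonneg.2 ?_)
      exact Finset.le_sup' (fun j => hgt (g j) d) ((mem_bots g v₀).2 ⟨hk, hc⟩)
    · rw [hqd, clin_eq, ← hc, zero_mul, add_zero]
      exact hv k hk hc.symm
    · rw [hqd, clin_eq_mul_sub _ _ _ hc.ne]
      refine mul_nonneg_of_nonpos_of_nonpos hc.le (sub_nonpos.2 ?_)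
      rw [h2]
      exact Finset.inf'_le (fun j => hgt (g j) d) ((mem_tops g v₀).2 ⟨hk, hc⟩)
  have hP : (v₀, 0) + s • qd ∈ closure (Om3 g) :=
    hclos (s • qd) hsnorm (fun k hk => by rw [clin_smul]; exact mul_nonneg hs0.le (hact k hk))
  -- the letter `j` vanishes at this point of the rim ray
  have hzero : lval κ μ j ((v₀, 0) + s • qd).1 = 0 := by
    simp only [Prod.fst_add, Prod.smul_fst, hqd]
    rw [lval_add, hjv, zero_add, klin_smul κ j s d, hkd, mul_zero]
  rcases hR _ hP ⟨j, hej, hzero⟩ with ⟨-, h0⟩ | ⟨p', hp', hne, hfst⟩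
  · simp only [Prod.snd_add, Prod.smul_snd, smul_eq_mul, zero_add, hqd] at h0
    have := mul_pos hs0 h1
    linarith
  · -- the closed fibre over the rim ray is the single point `s hlo d`
    apply hne
    have hnn := cval_nonneg_of_mem_closure g hp'
    set w' := p'.2 with hw'
    have hp'eq : p' = (v₀, 0) + (s • d, w') := by
      ext : 1
      · rw [hfst]; simp [hqd]
      · simp [hw']
    have hact' : ∀ k ∈ act g v₀, 0 ≤ clin (g k) (s • d, w') := fun k hk => by
      have := hnn k
      rwa [hp'eq, cval_shift, mem_act.1 hk, zero_add] at this
    -- bottoms: `w' ≥ s hlo d`; tops: `w' ≤ s hhi d = s hlo d`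
    have hge : s * hlo g v₀ hB d ≤ w' := by
      obtain ⟨k, hk, hkeq⟩ := Finset.exists_mem_eq_sup' hB fun j => hgt (g j) d
      obtain ⟨hka, hkc⟩ := (mem_bots g v₀).1 hk
      have := hact' k hka
      rw [clin_eq_mul_sub _ _ _ hkc.ne', hgt_smul] at this
      have := (mul_nonneg_iff_of_pos_left hkc).1 this
      rw [show hlo g v₀ hB d = hgt (g k) d from hkeq]
      linarith
    have hle : w' ≤ s * hlo g v₀ hB d := by
      obtain ⟨k, hk, hkeq⟩ := Finset.exists_mem_eq_inf' hT fun j => hgt (g j) d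
      obtain ⟨hka, hkc⟩ := (mem_tops g v₀).1 hk
      have := hact' k hka
      rw [clin_eq_mul_sub _ _ _ hkc.ne, hgt_smul] at this
      have : w' - s * hgt (g k) d ≤ 0 := by
        by_contra hcon
        push Not at hcon
        have := mul_neg_of_neg_of_pos hkc hcon
        linarith
      rw [h2, show hhi g v₀ hT d = hgt (g k) d from hkeq]
      linarith
    have hw'eq : w' = s * hlo g v₀ hB d := le_antisymm hle hge
    rw [hp'eq, hw'eq]
    simp [hqd]

/-- **Lower bound of the letter block near a transversal direction.** -/
theorem Wt_lower_dir {d : Fin 2 → ℝ}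
    (htr : ∀ j, e j ≠ 0 → lval κ μ j v₀ = 0 → κ j 0 * d 0 + κ j 1 * d 1 ≠ 0) :
    ∃ ε > 0, ∃ δ > 0, ∃ cW > 0, ∀ u : Fin 2 → ℝ, u ≠ 0 → ‖u‖ < δ → ‖udir u - d‖ < ε →
      cW * ‖u‖ ^ Eord κ μ e v₀ ≤ |Wt κ μ e (v₀ + u)| := by
  classical
  obtain ⟨δ, hδ, hunif⟩ := Wt_lower_unif κ μ e v₀
  -- the transversality margin
  obtain ⟨cm, hcm0, hcm⟩ := exists_pos_le_all
    (fun j : Fin m => if e j ≠ 0 ∧ lval κ μ j v₀ = 0 then |κ j 0 * d 0 + κ j 1 * d 1| / 2 else 1)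
    (fun j => by
      split_ifs with hj
      · exact half_pos (abs_pos.2 (htr j hj.1 hj.2))
      · exact one_pos)
  obtain ⟨cW, hcW, hlow⟩ := hunif cm hcm0
  have hev : ∀ᶠ x in 𝓝 d, ∀ j, e j ≠ 0 ∧ lval κ μ j v₀ = 0 →
      |κ j 0 * d 0 + κ j 1 * d 1| / 2 < |κ j 0 * x 0 + κ j 1 * x 1| := by
    refine eventually_all.2 fun j => ?_
    by_cases hj : e j ≠ 0 ∧ lval κ μ j v₀ = 0
    · have hc : Continuous fun x : Fin 2 → ℝ => |κ j 0 * x 0 + κ j 1 * x 1| := by fun_prop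
      have hpos : |κ j 0 * d 0 + κ j 1 * d 1| / 2 < |κ j 0 * d 0 + κ j 1 * d 1| :=
        half_lt_self (abs_pos.2 (htr j hj.1 hj.2))
      exact ((hc.tendsto d).eventually_const_lt hpos).mono fun x hx _ => hx
    · exact Eventually.of_forall fun x h => absurd h hj
  obtain ⟨ε, hε, hball⟩ := Metric.eventually_nhds_iff.1 hev
  refine ⟨ε, hε, δ, hδ, cW, hcW, fun u hu hud hdir => hlow u hud fun j hjv hej => ?_⟩
  have hx := hball (show dist (udir u) d < ε by rw [dist_dir_eq]; exact hdir) j ⟨hej, hjv⟩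
  have hcmj : cm ≤ |κ j 0 * d 0 + κ j 1 * d 1| / 2 := by
    have := hcm j; rwa [if_pos ⟨hej, hjv⟩] at this
  have hscale : κ j 0 * u 0 + κ j 1 * u 1 = ‖u‖ * (κ j 0 * (udir u) 0 + κ j 1 * (udir u) 1) := by
    conv_lhs => rw [← norm_smul_dir hu]
    rw [klin_smul κ j ‖u‖ (udir u)]
  rw [hscale, abs_mul, abs_of_nonneg (norm_nonneg u)]
  calc cm * ‖u‖ ≤ |κ j 0 * d 0 + κ j 1 * d 1| / 2 * ‖u‖ := mul_le_mul_of_nonneg_right hcmj (norm_nonneg u)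
    _ ≤ |κ j 0 * udir u 0 + κ j 1 * udir u 1| * ‖u‖ := mul_le_mul_of_nonneg_right hx.le (norm_nonneg u)
    _ = ‖u‖ * |κ j 0 * udir u 0 + κ j 1 * udir u 1| := mul_comm _ _

end RimDirs

end SepThree

/-- **Power counting on rim fibres** (registered part of `stub_separateThreeZero`; literal form of
`SepThree.bound_of_rim`): at a base point `v₀`, on vertical fibres equal to cone fibres inside the
dilated window `‖u‖ (A₁, B₁)` away from the pole plane, with the letter block bounded below by
`cW ‖u‖^E`, the exponent inequality `n + E < ord c + 3` for the real Taylor data `c` of the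
numerator gives the bound `FI i (v₀ + u) ≤ C ‖u‖⁻¹` for the fibre integral of the `i`-th
absolute Taylor piece, `‖u‖` small. -/
theorem separateThree_rimDirs {J m : ℕ} (g : Fin J → (Fin 2 → ℝ) × ℝ × ℝ) (κ : Fin m → Fin 2 → ℝ) (μ : Fin m → ℝ) (e : Fin m → ℕ) (N : ℕ) (q : ℕ → MvPolynomial (Fin 2) ℝ) (n : ℕ) (v₀ : Fin 2 → ℝ) {A₁ B₁ : ℝ} (hA : 0 < A₁) (hAB : A₁ < B₁) {cW : ℝ} (hcW : 0 < cW) {d : ℕ} (hNd : N ≤ d + 1) (c : SepThree.Coef d) (hc : ∀ (i : ℕ) (hi : i < N) (u : Fin 2 → ℝ), MvPolynomial.eval (v₀ + u) (q i) = SepTwo.pev₂ (c ⟨i, lt_of_lt_of_le hi hNd⟩) (u 0) (u 1)) (h : (SepThree.nz c).Nonempty) (hexp : n + SepThree.Eord κ μ e v₀ < SepThree.ord c h + 3) (i : ℕ) (hi : i < N) : ∃ δ > 0, ∃ C : ENNReal, C ≠ ⊤ ∧ ∀ u : Fin 2 → ℝ, u ≠ 0 → ‖u‖ < δ → SepThree.fib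 (SepThree.Om3 g) (v₀ + u) = SepThree.Kfib g v₀ u → SepThree.Kfib g v₀ u ⊆ Set.Ioo (‖u‖ * A₁) (‖u‖ * B₁) → cW * ‖u‖ ^ SepThree.Eord κ μ e v₀ ≤ |SepThree.Wt κ μ e (v₀ + u)| → SepThree.FI κ μ e q n (SepThree.Om3 g) i (v₀ + u) ≤ C * ENNReal.ofReal ‖u‖⁻¹ := by
  exact SepThree.bound_of_rim g κ μ e N q n v₀ hA hAB hcW hNd c hc h hexp i hi

end Summit.KontsevichZagierPeriods.ArrangementNormalForm.JanusBands
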